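import Literature.ModelTheory.ExponentialFields.AuxiliarySystem
import Literature.ModelTheory.ExponentialFields.ClosedTermTransfer
import Mathlib.RingTheory.MvPolynomial.Basic
import Mathlib.Algebra.MvPolynomial.Degrees
import HarnessLib

/-!
# Reduction of a flat exponential equation along an integer linear relation of a zero

Family `periods` (periods.S27), topic `Literature/ModelTheory/ExponentialFields`: a step of the
assembly of the conditional half of Macintyre–Wilkie's theorem
(`Literature.ModelTheory.ExponentialFields.macintyreWilkie_existential_of_schanuelProperty`).

Schanuel's conjecture only speaks about `ℚ`-linearly independent tuples, so before it can be
applied at a zero `ā` of an exponential polynomial the zero is made linearly independent by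
eliminating variables along integer relations.  Jones–Servi 2011 (transposing Macintyre–Wilkie
1996, §5), proof of Thm. 3.11: "We first show that we may assume that the coordinates of `ā` are
multiplicatively independent. So, suppose not, then there exist `b₁, …, bₙ ∈ ℤ` such that
`∏ aᵢ^{bᵢ} = 1`. Hence `aₙ = (∏_{i<n} aᵢ^{bᵢ})^{−1/bₙ}`. Define
`h(x₁, …, x_{n−1}) = ∏ xᵢ^{bᵢ m} g(x₁^{bₙ}, …, x_{n−1}^{bₙ}, (∏ xᵢ^{bᵢ})^{−1})` … `h ∈ M_n(ℤ[α])` …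
in every model of `T` every zero `(c₁, …, c_{n−1})` of `h` gives rise to a zero … of `g`. Hence we
can repeat the process until … the coordinates of the zero are multiplicatively independent."

For `exp` the relations are additive (`Σ bᵢ aᵢ = 0`, `bᵢ ∈ ℤ`) and the substitutions are
`xᵢ ↦ Σₖ cᵢₖ x'ₖ`, `e^{xᵢ} ↦ ∏ₖ (e^{x'ₖ})^{cᵢₖ}`; to stay inside *polynomials* in `(x̄', e^{x̄'})`
the matrix `(cᵢₖ)` is chosen with **non-negative** integer entries (possible after flipping the
sign of one coordinate, `flipPoly`, when all non-zero `bᵢ` have the same sign, and trivially when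
only one `bᵢ` is non-zero).  This file provides (all proved):

* `ExpPoly.substPoly c P` (`MvPolynomial.bind₁` along a non-negative integer matrix) and
  `expAEval_substPoly`: in ANY commutative ring with a map `E` satisfying `E (x + y) = E x * E y`,
  `E 0 = 1`: `(substPoly c P)(x̄', E x̄') = P(c x̄', E (c x̄'))`;
* `ExpPoly.flipPoly p P` and `expAEval_flipPoly`: `(flipPoly p P)(ȳ, E ȳ) = E(y_p)^D · P(x̄, E x̄)`
  with `x̄ = ȳ` except `x_p = −y_p` (in fields, with `E(−y) = (E y)⁻¹`);
* `ExpPoly.zeroPoly p P` (the substitution `x_p ↦ 0`, `e^{x_p} ↦ 1`);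
* **`ExpPoly.reduce_step`**: from `P ∈ ℤ[x₀…x_N, y₀…y_N]` with a real zero `ā` satisfying a
  non-trivial integer relation `Σ bᵢ aᵢ = 0`, an `h ∈ ℤ[x'₁…x'_N, y'₁…y'_N]` (one variable fewer)
  with a real zero, such that in every ordered field with an `IsOrderedExp` map, every zero of
  `h` yields a zero of `P`.

## References

* G. O. Jones, T. Servi, *On the decidability of the real field with a generic power function*,
  J. Symb. Log. 76 (2011), Thm. 3.11 (proof, first reduction).
* A. Macintyre, A. J. Wilkie, *On the decidability of the real exponential field* (1996), §5.
-/

noncomputable section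

open scoped BigOperators
open MvPolynomial

namespace Literature.ModelTheory.ExponentialFields

namespace ExpPoly

/-! ### Exponentials of non-negative integer combinations -/

section ExpHom

variable {K : Type*} [CommRing K] {E : K → K} (hadd : ∀ x y, E (x + y) = E x * E y) (h0 : E 0 = 1)
include hadd h0

/-- `E (n • x) = (E x)ⁿ`. [folklore] -/
theorem exp_nsmul (n : ℕ) (x : K) : E (n • x) = E x ^ n := by
  induction n with
  | zero => simp [h0]
  | succ n ih => rw [succ_nsmul, hadd, ih, pow_succ]

/-- `E (Σₖ cₖ • xₖ) = ∏ₖ (E xₖ)^{cₖ}` for natural coefficients. [folklore] -/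
theorem exp_sum_nsmul {ι : Type*} (s : Finset ι) (c : ι → ℕ) (x : ι → K) :
    E (∑ k ∈ s, c k • x k) = ∏ k ∈ s, E (x k) ^ c k := by
  classical
  induction s using Finset.induction_on with
  | empty => simp [h0]
  | insert a s ha ih => rw [Finset.sum_insert ha, Finset.prod_insert ha, hadd, exp_nsmul hadd h0, ih]

end ExpHom

/-! ### Substitution along a non-negative integer matrix -/

section Subst

variable {N N' : ℕ}

/-- The substitution `xᵢ ↦ Σₖ cᵢₖ x'ₖ`, `yᵢ ↦ ∏ₖ y'ₖ^{cᵢₖ}` (`c` a non-negative integer matrix). [cite: JonesServi2011, Thm. 3.11 (proof, first reduction)] -/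
def substMap (c : Fin N → Fin N' → ℕ) : Fin N ⊕ Fin N → MvPolynomial (Fin N' ⊕ Fin N') ℤ
  | Sum.inl i => ∑ k, (c i k : MvPolynomial (Fin N' ⊕ Fin N') ℤ) * X (Sum.inl k)
  | Sum.inr i => ∏ k, X (Sum.inr k) ^ c i k

/-- The substituted polynomial `P(c x̄', ∏ (y')^{c})`. [cite: JonesServi2011, Thm. 3.11 (proof, first reduction)] -/
def substPoly (c : Fin N → Fin N' → ℕ) (P : MvPolynomial (Fin N ⊕ Fin N) ℤ) :
    MvPolynomial (Fin N' ⊕ Fin N') ℤ :=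
  bind₁ (substMap c) P

/-- The linear map `x̄' ↦ c x̄'` on tuples. [folklore] -/
def linSub {K : Type*} [CommRing K] (c : Fin N → Fin N' → ℕ) (x' : Fin N' → K) : Fin N → K :=
  fun i => ∑ k, c i k • x' k

/-- **Evaluation of the substituted polynomial**: `(substPoly c P)(x̄', E x̄') = P(c x̄', E(c x̄'))`
in any commutative ring with `E (x + y) = E x * E y`, `E 0 = 1`. [folklore] -/
theorem expAEval_substPoly {K : Type*} [CommRing K] {E : K → K}
    (hadd : ∀ x y, E (x + y) = E x * E y) (h0 : E 0 = 1)
    (c : Fin N → Fin N' → ℕ) (P : MvPolynomial (Fin N ⊕ Fin N) ℤ) (x' : Fin N' → K) :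
    expAEval E (substPoly c P) x' = expAEval E P (linSub c x') := by
  rw [expAEval, substPoly, aeval_bind₁, expAEval]
  have : (fun i => MvPolynomial.aeval (Sum.elim x' (E ∘ x')) (substMap c i)) =
      Sum.elim (linSub c x') (E ∘ linSub c x') := by
    funext v
    rcases v with i | i
    · simp [substMap, linSub, map_sum, nsmul_eq_mul]
    · simp only [substMap, map_prod, map_pow, aeval_X, Sum.elim_inr, Function.comp_apply, linSub]
      rw [exp_sum_nsmul hadd h0]
  rw [this]

end Subst

/-! ### Flipping the sign of one coordinate -/

section Flip

variable {N : ℕ}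

/-- The exponent vector of a monomial with the `y_p`-exponent replaced by `D − (y_p-exponent)`. [folklore] -/
def flipExp (p : Fin N) (D : ℕ) (m : (Fin N ⊕ Fin N) →₀ ℕ) : (Fin N ⊕ Fin N) →₀ ℕ :=
  m.update (Sum.inr p) (D - m (Sum.inr p))

/-- **The flipped polynomial**: `Σₘ coeffₘ · (−1)^{m(x_p)} · x̄^{m_x} ȳ^{m_y[p ↦ D − m(y_p)]}`,
`D` the `y_p`-degree of `P`; it represents `e^{D x_p} · P` after `x_p ↦ −x_p`. [cite: JonesServi2011, Thm. 3.11 (proof, first reduction)] -/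
def flipPoly (p : Fin N) (P : MvPolynomial (Fin N ⊕ Fin N) ℤ) : MvPolynomial (Fin N ⊕ Fin N) ℤ :=
  ∑ m ∈ P.support, monomial (flipExp p (P.degreeOf (Sum.inr p)) m) ((-1) ^ m (Sum.inl p) * P.coeff m)

/-- Evaluating a monomial at `(x̄, E x̄)`: `∏ᵥ ptᵥ^{m v}` with `pt = (x̄, E x̄)`. [folklore] -/
theorem aeval_monomial_expPt {K : Type*} [CommRing K] (E : K → K) (x : Fin N → K)
    (m : (Fin N ⊕ Fin N) →₀ ℕ) (a : ℤ) :
    MvPolynomial.aeval (Sum.elim x (E ∘ x)) (monomial m a) =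
      (a : K) * ∏ v, (Sum.elim x (E ∘ x) v) ^ m v := by
  rw [aeval_monomial, Finsupp.prod_fintype _ _ (fun v => by simp), Algebra.algebraMap_eq_smul_one,
    zsmul_eq_mul, mul_one]

/-- **Evaluation of the flipped polynomial** in a field with `E (x + y) = E x * E y`, `E 0 = 1`:
`(flipPoly p P)(ȳ, E ȳ) = E(y_p)^D · P(x̄, E x̄)` where `x̄ = ȳ` except `x_p = −y_p`. [folklore] -/
theorem expAEval_flipPoly {K : Type*} [Field K] {E : K → K}
    (hadd : ∀ x y, E (x + y) = E x * E y) (h0 : E 0 = 1)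
    (p : Fin N) (P : MvPolynomial (Fin N ⊕ Fin N) ℤ) (y : Fin N → K) :
    expAEval E (flipPoly p P) y =
      E (y p) ^ P.degreeOf (Sum.inr p) * expAEval E P (Function.update y p (-y p)) := by
  classical
  set D := P.degreeOf (Sum.inr p) with hD
  set x : Fin N → K := Function.update y p (-y p) with hx
  have hEne : E (y p) ≠ 0 := fun h => by
    have := hadd (y p) (-(y p)); rw [add_neg_cancel, h0, h, zero_mul] at this; exact one_ne_zero this
  have hEneg : E (-(y p)) = (E (y p))⁻¹ := by
    have := hadd (y p) (-(y p)); rw [add_neg_cancel, h0] at this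
    exact eq_inv_of_mul_eq_one_right this.symm
  -- expand both sides as sums over the support
  rw [expAEval, flipPoly, map_sum, expAEval, show MvPolynomial.aeval (Sum.elim x (E ∘ x)) P =
      ∑ m ∈ P.support, MvPolynomial.aeval (Sum.elim x (E ∘ x)) (monomial m (P.coeff m)) by
    conv_lhs => rw [P.as_sum]; rw [map_sum], Finset.mul_sum]
  refine Finset.sum_congr rfl fun m hm => ?_
  rw [aeval_monomial_expPt, aeval_monomial_expPt]
  have hmD : m (Sum.inr p) ≤ D := hD ▸ monomial_le_degreeOf (Sum.inr p) hm
  -- split the products at the variables `inl p` and `inr p`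
  rw [Fintype.prod_sum_type, Fintype.prod_sum_type]
  rw [← Finset.mul_prod_erase _ _ (Finset.mem_univ p), ← Finset.mul_prod_erase Finset.univ
    (fun i => (Sum.elim y (E ∘ y) (Sum.inr i)) ^ (flipExp p D m) (Sum.inr i)) (Finset.mem_univ p)]
  conv_rhs => rw [← Finset.mul_prod_erase _ _ (Finset.mem_univ p), ← Finset.mul_prod_erase Finset.univ
    (fun i => (Sum.elim x (E ∘ x) (Sum.inr i)) ^ m (Sum.inr i)) (Finset.mem_univ p)]
  -- the factors away from `p` agree
  have h1 : ∏ i ∈ Finset.univ.erase p, (Sum.elim y (E ∘ y) (Sum.inl i)) ^ (flipExp p D m) (Sum.inl i) =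
      ∏ i ∈ Finset.univ.erase p, (Sum.elim x (E ∘ x) (Sum.inl i)) ^ m (Sum.inl i) := by
    refine Finset.prod_congr rfl fun i hi => ?_
    have hip : i ≠ p := Finset.ne_of_mem_erase hi
    simp [flipExp, Finsupp.update_apply, hx, Function.update_of_ne hip]
  have h2 : ∏ i ∈ Finset.univ.erase p, (Sum.elim y (E ∘ y) (Sum.inr i)) ^ (flipExp p D m) (Sum.inr i) =
      ∏ i ∈ Finset.univ.erase p, (Sum.elim x (E ∘ x) (Sum.inr i)) ^ m (Sum.inr i) := by
    refine Finset.prod_congr rfl fun i hi => ?_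
    have hip : i ≠ p := Finset.ne_of_mem_erase hi
    simp [flipExp, Finsupp.update_apply, hip, hx]
  rw [h1, h2]
  -- the factors at `p`
  have h3 : (Sum.elim y (E ∘ y) (Sum.inl p)) ^ (flipExp p D m) (Sum.inl p) = y p ^ m (Sum.inl p) := by
    simp [flipExp, Finsupp.update_apply]
  have h4 : (Sum.elim y (E ∘ y) (Sum.inr p)) ^ (flipExp p D m) (Sum.inr p) = E (y p) ^ (D - m (Sum.inr p)) := by
    simp [flipExp, Finsupp.update_apply]
  have h5 : (Sum.elim x (E ∘ x) (Sum.inl p)) ^ m (Sum.inl p) = (-y p) ^ m (Sum.inl p) := by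
    simp [hx]
  have h6 : (Sum.elim x (E ∘ x) (Sum.inr p)) ^ m (Sum.inr p) = (E (y p))⁻¹ ^ m (Sum.inr p) := by
    simp [hx, hEneg]
  rw [h3, h4, h5, h6]
  -- arithmetic: `(-1)^a c · y^a · E^{D-e} · R = E^D · (c · (-y)^a · E^{-e} · R)`
  have hpow : E (y p) ^ (D - m (Sum.inr p)) = E (y p) ^ D * (E (y p))⁻¹ ^ m (Sum.inr p) := by
    rw [inv_pow, ← div_eq_mul_inv, eq_div_iff (pow_ne_zero _ hEne), ← pow_add, Nat.sub_add_cancel hmD]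
  rw [hpow, neg_pow]
  push_cast
  ring

end Flip

/-! ### Setting one coordinate to zero -/

section ZeroSubst

variable {N : ℕ}

/-- The substitution `x_p ↦ 0`, `y_p ↦ 1`, the other variables kept and re-indexed by
`Fin.succAbove p`. [folklore] -/
def zeroMap (p : Fin (N + 1)) : Fin (N + 1) ⊕ Fin (N + 1) → MvPolynomial (Fin N ⊕ Fin N) ℤ
  | Sum.inl i => Fin.succAboveCases p 0 (fun k => X (Sum.inl k)) i
  | Sum.inr i => Fin.succAboveCases p 1 (fun k => X (Sum.inr k)) i

/-- The polynomial `P` with `x_p ↦ 0`, `e^{x_p} ↦ 1`. [folklore] -/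
def zeroPoly (p : Fin (N + 1)) (P : MvPolynomial (Fin (N + 1) ⊕ Fin (N + 1)) ℤ) :
    MvPolynomial (Fin N ⊕ Fin N) ℤ :=
  bind₁ (zeroMap p) P

/-- Evaluation of `zeroPoly`: `(zeroPoly p P)(x̄', E x̄') = P(x̄, E x̄)` with `x̄` obtained from
`x̄'` by inserting `0` at position `p` (given `E 0 = 1`). [folklore] -/
theorem expAEval_zeroPoly {K : Type*} [CommRing K] {E : K → K} (h0 : E 0 = 1)
    (p : Fin (N + 1)) (P : MvPolynomial (Fin (N + 1) ⊕ Fin (N + 1)) ℤ) (x' : Fin N → K) :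
    expAEval E (zeroPoly p P) x' = expAEval E P (Fin.insertNth p 0 x') := by
  rw [expAEval, zeroPoly, aeval_bind₁, expAEval]
  have : (fun i => MvPolynomial.aeval (Sum.elim x' (E ∘ x')) (zeroMap p i)) =
      Sum.elim (Fin.insertNth p 0 x') (E ∘ Fin.insertNth p 0 x') := by
    funext v
    rcases v with i | i
    · refine Fin.succAboveCases p ?_ (fun k => ?_) i
      · simp [zeroMap, Fin.insertNth_apply_same]
      · simp [zeroMap, Fin.insertNth_apply_succAbove]
    · refine Fin.succAboveCases p ?_ (fun k => ?_) i
      · simp [zeroMap, Fin.insertNth_apply_same, h0]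
      · simp [zeroMap, Fin.insertNth_apply_succAbove]
  rw [this]

end ZeroSubst

/-! ### The reduction step -/

section Reduce

variable {N : ℕ}

/-- The non-negative substitution matrix attached to an integer relation `b` with `b p > 0`,
`b q < 0`: for `i ≠ p` with `bᵢ ≤ 0`, `xᵢ = b_p x'ᵢ` and `x_p` gains `−bᵢ x'ᵢ`; for `i ≠ p` with
`bᵢ > 0`, `xᵢ = (−b_q) x'ᵢ` and `x_q` gains `bᵢ x'ᵢ` (variables `x'` indexed by `i ≠ p` through
`Fin.succAbove p`). Every column is a non-negative integer vector in the hyperplane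
`Σ bᵢ xᵢ = 0`. [folklore] -/
def relMatrix (b : Fin (N + 1) → ℤ) (p q : Fin (N + 1)) : Fin (N + 1) → Fin N → ℕ :=
  fun i k =>
    let j := p.succAbove k            -- the original index of the `k`-th new variable
    if b j ≤ 0 then
      (if i = j then (b p).toNat else 0) + (if i = p then (-b j).toNat else 0)
    else
      (if i = j then (-b q).toNat else 0) + (if i = q then (b j).toNat else 0)

/-- **The columns of `relMatrix` lie in the hyperplane**: `Σᵢ bᵢ (relMatrix b p q i k) = 0`
(for `b p > 0 > b q`, `q ≠ p`). [folklore] -/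
theorem sum_mul_relMatrix (b : Fin (N + 1) → ℤ) {p q : Fin (N + 1)} (hp : 0 < b p) (hq : b q < 0)
    (k : Fin N) : ∑ i, b i * (relMatrix b p q i k : ℤ) = 0 := by
  classical
  have hqp : q ≠ p := fun h => by rw [h] at hq; exact lt_asymm hp hq
  set j := p.succAbove k with hj
  have hjp : j ≠ p := Fin.succAbove_ne p k
  simp only [relMatrix, ← hj]
  by_cases hbj : b j ≤ 0
  · simp only [hbj, ↓reduceIte, Nat.cast_add, Nat.cast_ite, Nat.cast_zero, mul_add, Finset.sum_add_distrib,
      mul_ite, mul_zero, Finset.sum_ite_eq', Finset.mem_univ]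
    rw [Int.toNat_of_nonneg hp.le, Int.toNat_of_nonneg (by linarith)]
    ring
  · have hbj' : 0 < b j := not_le.1 hbj
    simp only [hbj, ↓reduceIte, Nat.cast_add, Nat.cast_ite, Nat.cast_zero, mul_add,
      Finset.sum_add_distrib, mul_ite, mul_zero, Finset.sum_ite_eq', Finset.mem_univ]
    rw [Int.toNat_of_nonneg (by linarith), Int.toNat_of_nonneg hbj'.le]
    ring

/-! #### The entries of `relMatrix` -/

section Entries

variable (b : Fin (N + 1) → ℤ) {p q : Fin (N + 1)} (hp : 0 < b p) (hq : b q < 0)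
include hp hq

/-- Row `p` of `relMatrix`. [folklore] -/
theorem relMatrix_row_p (k : Fin N) :
    relMatrix b p q p k = if b (p.succAbove k) ≤ 0 then (-b (p.succAbove k)).toNat else 0 := by
  have hqp : q ≠ p := fun h => by rw [h] at hq; exact lt_asymm hp hq
  have hjp : p.succAbove k ≠ p := Fin.succAbove_ne p k
  simp [relMatrix, hjp.symm, hqp.symm]

omit hp in
/-- The diagonal entry: row `p.succAbove k`, column `k`. [folklore] -/
theorem relMatrix_diag (k : Fin N) :
    relMatrix b p q (p.succAbove k) k =
      if b (p.succAbove k) ≤ 0 then (b p).toNat else (-b q).toNat := by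
  have hjp : p.succAbove k ≠ p := Fin.succAbove_ne p k
  by_cases hbj : b (p.succAbove k) ≤ 0
  · simp [relMatrix, hbj, hjp]
  · have hjq : p.succAbove k ≠ q := fun h => hbj (by rw [h]; exact hq.le)
    simp [relMatrix, hbj, hjq]

omit hp hq in
/-- Off-diagonal entries away from rows `p`, `q` vanish. [folklore] -/
theorem relMatrix_off {k₀ k : Fin N} (hk : k₀ ≠ k) (hk₀q : p.succAbove k₀ ≠ q) :
    relMatrix b p q (p.succAbove k₀) k = 0 := by
  have hjp : p.succAbove k₀ ≠ p := Fin.succAbove_ne p k₀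
  have hne : p.succAbove k₀ ≠ p.succAbove k := fun h => hk (Fin.succAbove_right_injective h)
  by_cases hbj : b (p.succAbove k) ≤ 0
  · simp [relMatrix, hbj, hjp, hne]
  · simp [relMatrix, hbj, hne, hk₀q]

/-- Row `q`, columns `k ≠ kq`. [folklore] -/
theorem relMatrix_row_q {kq k : Fin N} (hkq : p.succAbove kq = q) (hk : k ≠ kq) :
    relMatrix b p q q k = if b (p.succAbove k) ≤ 0 then 0 else (b (p.succAbove k)).toNat := by
  have hqp : q ≠ p := fun h => by rw [h] at hq; exact lt_asymm hp hq
  have hne : q ≠ p.succAbove k := by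
    rw [← hkq]; exact fun h => hk (Fin.succAbove_right_injective h).symm
  by_cases hbj : b (p.succAbove k) ≤ 0
  · simp [relMatrix, hbj, hne, hqp]
  · simp [relMatrix, hbj, hne]

/-- Row `q`, column `kq`. [folklore] -/
theorem relMatrix_q_kq {kq : Fin N} (hkq : p.succAbove kq = q) :
    relMatrix b p q q kq = (b p).toNat := by
  have hqp : q ≠ p := fun h => by rw [h] at hq; exact lt_asymm hp hq
  simp [relMatrix, hkq, hq.le, hqp]

end Entries

/-- **A real preimage**: if `Σ bᵢ aᵢ = 0` with `b p > 0 > b q`, then `ā = relMatrix · ā'` for an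
explicit real `ā'`. [folklore] -/
theorem exists_linSub_relMatrix_eq (b : Fin (N + 1) → ℤ) {p q : Fin (N + 1)} (hp : 0 < b p)
    (hq : b q < 0) (a : Fin (N + 1) → ℝ) (hrel : ∑ i, (b i : ℝ) * a i = 0) :
    ∃ a' : Fin N → ℝ, linSub (relMatrix b p q) a' = a := by
  classical
  have hqp : q ≠ p := fun h => by rw [h] at hq; exact lt_asymm hp hq
  obtain ⟨kq, hkq⟩ := Fin.exists_succAbove_eq hqp
  have hbpR : (0 : ℝ) < b p := by exact_mod_cast hp
  have hbqR : (b q : ℝ) < 0 := by exact_mod_cast hq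
  have hbp0 : (b p : ℝ) ≠ 0 := hbpR.ne'
  have hbq0 : (-(b q : ℝ)) ≠ 0 := by linarith
  have hbq0' : (b q : ℝ) ≠ 0 := hbqR.ne
  -- casts of the `toNat`s
  have cast_bp : (((b p).toNat : ℕ) : ℝ) = b p := by exact_mod_cast Int.toNat_of_nonneg hp.le
  have cast_bq : (((-b q).toNat : ℕ) : ℝ) = -(b q : ℝ) := by
    have := Int.toNat_of_nonneg (show 0 ≤ -b q by linarith); exact_mod_cast this
  have cast_neg : ∀ k, b (p.succAbove k) ≤ 0 →
      (((-b (p.succAbove k)).toNat : ℕ) : ℝ) = -(b (p.succAbove k) : ℝ) := fun k hk => by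
    have := Int.toNat_of_nonneg (show 0 ≤ -b (p.succAbove k) by linarith); exact_mod_cast this
  have cast_pos : ∀ k, ¬ b (p.succAbove k) ≤ 0 →
      (((b (p.succAbove k)).toNat : ℕ) : ℝ) = (b (p.succAbove k) : ℝ) := fun k hk => by
    have := Int.toNat_of_nonneg (show 0 ≤ b (p.succAbove k) by linarith [not_le.1 hk]); exact_mod_cast this
  -- the data
  set a₀ : Fin N → ℝ := fun k =>
    if b (p.succAbove k) ≤ 0 then a (p.succAbove k) / b p else a (p.succAbove k) / (-(b q : ℝ)) with ha₀
  set Spos : ℝ := ∑ k ∈ Finset.univ.erase kq,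
    (if b (p.succAbove k) ≤ 0 then 0 else (b (p.succAbove k) : ℝ) * a (p.succAbove k)) with hSpos
  set Sneg : ℝ := ∑ k ∈ Finset.univ.erase kq,
    (if b (p.succAbove k) ≤ 0 then (b (p.succAbove k) : ℝ) * a (p.succAbove k) else 0) with hSneg
  set a' : Fin N → ℝ := Function.update a₀ kq ((a q - Spos / (-(b q : ℝ))) / b p) with ha'
  -- the relation, split at `p` and then at `kq`
  have hrel' : (b p : ℝ) * a p + ((b q : ℝ) * a q + (Sneg + Spos)) = 0 := by
    have h1 : ∑ i, (b i : ℝ) * a i = (b p : ℝ) * a p + ∑ k, (b (p.succAbove k) : ℝ) * a (p.succAbove k) :=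
      Fin.sum_univ_succAbove _ p
    have h2 : ∑ k, (b (p.succAbove k) : ℝ) * a (p.succAbove k) =
        (b (p.succAbove kq) : ℝ) * a (p.succAbove kq) +
          ∑ k ∈ Finset.univ.erase kq, (b (p.succAbove k) : ℝ) * a (p.succAbove k) :=
      (Finset.add_sum_erase _ _ (Finset.mem_univ kq)).symm
    have h3 : ∑ k ∈ Finset.univ.erase kq, (b (p.succAbove k) : ℝ) * a (p.succAbove k) = Sneg + Spos := by
      rw [hSneg, hSpos, ← Finset.sum_add_distrib]
      refine Finset.sum_congr rfl fun k _ => ?_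
      split_ifs <;> simp
    rw [h1, h2, h3, hkq] at hrel
    exact hrel
  have hap : a p = -((b q : ℝ) * a q + (Sneg + Spos)) / b p := by
    field_simp
    linarith [hrel']
  have ha'kq : a' kq = (a q - Spos / (-(b q : ℝ))) / b p := by rw [ha', Function.update_self]
  have ha'ne : ∀ k, k ≠ kq → a' k = a₀ k := fun k hk => by rw [ha', Function.update_of_ne hk]
  refine ⟨a', funext fun i => ?_⟩
  simp only [linSub, nsmul_eq_mul]
  rcases Fin.eq_self_or_eq_succAbove p i with hi | ⟨k₀, hi⟩
  · -- row `p`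
    rw [hi]
    have hterm : ∀ k ∈ Finset.univ.erase kq, ((relMatrix b p q p k : ℕ) : ℝ) * a' k =
        (if b (p.succAbove k) ≤ 0 then (b (p.succAbove k) : ℝ) * a (p.succAbove k) else 0) *
          (-(b p : ℝ)⁻¹) := by
      intro k hk
      have hkne : k ≠ kq := Finset.ne_of_mem_erase hk
      rw [relMatrix_row_p b hp hq, ha'ne k hkne, ha₀]
      by_cases hbk : b (p.succAbove k) ≤ 0
      · simp only [hbk, ↓reduceIte]
        rw [cast_neg k hbk]
        field_simp
      · simp [hbk]
    rw [← Finset.add_sum_erase _ _ (Finset.mem_univ kq), Finset.sum_congr rfl hterm, ← Finset.sum_mul,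
      ← hSneg, relMatrix_row_p b hp hq, hkq, if_pos hq.le, cast_bq, ha'kq, hap]
    field_simp
    ring
  · rw [hi]
    by_cases hk₀ : k₀ = kq
    · -- row `q`
      rw [hk₀, hkq]
      have hterm : ∀ k ∈ Finset.univ.erase kq, ((relMatrix b p q q k : ℕ) : ℝ) * a' k =
          (if b (p.succAbove k) ≤ 0 then 0 else (b (p.succAbove k) : ℝ) * a (p.succAbove k)) *
            (-(b q : ℝ))⁻¹ := by
        intro k hk
        have hkne : k ≠ kq := Finset.ne_of_mem_erase hk
        rw [relMatrix_row_q b hp hq hkq hkne, ha'ne k hkne, ha₀]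
        by_cases hbk : b (p.succAbove k) ≤ 0
        · simp [hbk]
        · simp only [hbk, ↓reduceIte]
          rw [cast_pos k hbk]
          field_simp
      rw [← Finset.add_sum_erase _ _ (Finset.mem_univ kq), Finset.sum_congr rfl hterm, ← Finset.sum_mul,
        ← hSpos, relMatrix_q_kq b hp hq hkq, cast_bp, ha'kq]
      field_simp
      ring
    · -- row `p.succAbove k₀ ∉ {p, q}`
      have hk₀q : p.succAbove k₀ ≠ q := by
        rw [← hkq]; exact fun h => hk₀ (Fin.succAbove_right_injective h)
      rw [Finset.sum_eq_single k₀ (fun k _ hk => by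
          rw [relMatrix_off b (Ne.symm hk) hk₀q, Nat.cast_zero, zero_mul])
        (fun h => (h (Finset.mem_univ _)).elim), relMatrix_diag b hq, ha'ne k₀ hk₀, ha₀]
      by_cases hbk : b (p.succAbove k₀) ≤ 0
      · simp only [hbk, ↓reduceIte]
        rw [cast_bp]
        field_simp
      · simp only [hbk, ↓reduceIte]
        rw [cast_bq]
        field_simp

/-! #### The step -/

/-- **The reduction step along an integer relation** (Jones–Servi 2011, proof of Thm. 3.11,
first reduction, for `exp`): from `P ∈ ℤ[x₀…x_N, y₀…y_N]` with a real zero `ā` whose coordinates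
satisfy `Σ bᵢ aᵢ = 0` for an integer vector `b` with (at least) two non-zero entries of opposite
signs `b p > 0 > b q`, the polynomial `substPoly (relMatrix b p q) P` in `N` pairs of variables
has a real zero, and in every commutative ring with an exponential-like `E` each of its zeros
`x̄'` gives the zero `relMatrix · x̄'` of `P`. [cite: JonesServi2011, Thm. 3.11 (proof, first reduction)] -/
theorem reduce_mixed (P : MvPolynomial (Fin (N + 1) ⊕ Fin (N + 1)) ℤ) {a : Fin (N + 1) → ℝ}
    (ha : expEval P a = 0) (b : Fin (N + 1) → ℤ) {p q : Fin (N + 1)} (hp : 0 < b p) (hq : b q < 0)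
    (hrel : ∑ i, (b i : ℝ) * a i = 0) :
    (∃ a' : Fin N → ℝ, expEval (substPoly (relMatrix b p q) P) a' = 0) ∧
      ∀ {K : Type*} [CommRing K] {E : K → K}, (∀ x y, E (x + y) = E x * E y) → E 0 = 1 →
        ∀ x' : Fin N → K, expAEval E (substPoly (relMatrix b p q) P) x' = 0 →
          expAEval E P (linSub (relMatrix b p q) x') = 0 := by
  refine ⟨?_, fun hadd h0 x' hx' => by rwa [expAEval_substPoly hadd h0] at hx'⟩
  obtain ⟨a', ha'⟩ := exists_linSub_relMatrix_eq b hp hq a hrel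
  refine ⟨a', ?_⟩
  rw [← expAEval_real, expAEval_substPoly Real.exp_add Real.exp_zero, ha', expAEval_real, ha]

/-- **The reduction step when the coordinate `a_p` vanishes** (a relation with a single non-zero
coefficient `b p`): `zeroPoly p P` has a real zero, and each of its zeros in a commutative ring
with `E 0 = 1` gives a zero of `P` (insert `0` at `p`). [folklore] -/
theorem reduce_zero (P : MvPolynomial (Fin (N + 1) ⊕ Fin (N + 1)) ℤ) {a : Fin (N + 1) → ℝ}
    (ha : expEval P a = 0) (p : Fin (N + 1)) (hap : a p = 0) :
    (∃ a' : Fin N → ℝ, expEval (zeroPoly p P) a' = 0) ∧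
      ∀ {K : Type*} [CommRing K] {E : K → K}, E 0 = 1 →
        ∀ x' : Fin N → K, expAEval E (zeroPoly p P) x' = 0 →
          expAEval E P (Fin.insertNth p 0 x') = 0 := by
  refine ⟨⟨fun k => a (p.succAbove k), ?_⟩, fun h0 x' hx' => by rwa [expAEval_zeroPoly h0] at hx'⟩
  rw [← expAEval_real, expAEval_zeroPoly Real.exp_zero]
  have : Fin.insertNth p (0 : ℝ) (fun k => a (p.succAbove k)) = a := by
    rw [← hap]; exact Fin.insertNth_self_removeNth p a
  rw [this, expAEval_real, ha]

/-- **The flip**: `flipPoly p P` has a real zero iff `P` does, along `x_p ↦ −x_p`; in fields with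
an exponential-like `E`, zeros correspond. [folklore] -/
theorem expAEval_flipPoly_eq_zero_iff {K : Type*} [Field K] {E : K → K}
    (hadd : ∀ x y, E (x + y) = E x * E y) (h0 : E 0 = 1)
    (p : Fin N) (P : MvPolynomial (Fin N ⊕ Fin N) ℤ) (y : Fin N → K) :
    expAEval E (flipPoly p P) y = 0 ↔ expAEval E P (Function.update y p (-y p)) = 0 := by
  have hEne : E (y p) ≠ 0 := fun h => by
    have := hadd (y p) (-(y p)); rw [add_neg_cancel, h0, h, zero_mul] at this; exact one_ne_zero this
  rw [expAEval_flipPoly hadd h0, mul_eq_zero, or_iff_right (pow_ne_zero _ hEne)]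

end Reduce

end ExpPoly

end Literature.ModelTheory.ExponentialFields

end
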